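/-
Copyright: statement-level skeleton of a published paper (lit-balaban cell, Phase-2 proof seat p39 gen 9). No proof claims
beyond what the kernel checks below.
-/
import Literature.MathematicalPhysics.QuantumFieldTheory.Balaban1983to89.B3Eq316ResolventZeroLattice

/-!
# B3 — T. Bałaban, *(Higgs)₂,₃ quantum fields in a finite volume. III. Renormalization*, CMP **88** (1983) 411–445
[Balaban1983Higgs3], p. 437 [PDF 27]: *"Using the inequalities |C^ξ(y − y′)| ≦ O(1)e^{−½|y−y′|}/|y − y′|, |G^ξ_{j″}(0; y, y′)| ≦
O(1)e^{−δ₀|y−y′|}/|y − y′|, and the corresponding inequalities for derivatives, we can estimate (3.16) by a constant"* — THE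
ESTIMATES OF THE DIFFERENCE KERNEL `M = G^ξ_{j″}(0) − C^ξ = G^ξ_{j″}(0)(1 − m² − aP)C^ξ` OF (3.16) ON THE PRINTED INFINITE LATTICE ξℤ³

statement-level skeleton of published theorems with citation tags; proofs where landed; nothing here is a claim about
the Yang–Mills mass gap

PDF held: `paper:balaban1983-higgs-2-3-quantum-fields-finite-volume` (journal page = PDF page + 410); p. 437 [PDF 27] and p. 441
[PDF 31] (*"If at least one propagator G_{j₀}(0) is replaced by G_{j₀}(0)(1 − m²_{j₀} − a_{j₀}P_{j₀})C^ξ, then we get a convergent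
expression"*) read on the ×2 renders `run/shared/lean/pub/pub-balaban/b2b-balaban-ref1/pages/1983-cmp88-higgs23-III/
1983-cmp88-higgs23-III-p027-x2.png`, `…-p031-x2.png`.  Rows **B3.Eq3.11-3.17** and **B3.Eq3.25-3.32** of
`HOME/lit-balaban-r15/ROWS-B3.md` (fold owner r15); file 4 of the p39 gen-9 programme «the §3 vector self-energy sentences on
the PRINTED infinite lattice ξℤ³» (`B3Eq316ResolventZeroLattice` proves the identity; this file proves the estimates of its
right-hand side that make the (3.26) sums converge uniformly in the spacing; `B3Pi2ZeroLattice` assembles them).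
WHAT IS REPRODUCED (`d = 3`, `ξ = L^{−k}`, volume element `Σ ξ³`, profiles `P_q^δ(u) = (ξ·max(1,|u|_∞))^{−q}e^{−δξ|u|_∞}` =
`prof ξ δ q u`; constants existential, functions of `L` and the window `[a₋,a₊] × [0,m²₊]`, UNIFORM IN `k ≥ 1`):
* §1 MODEL-FREE: `abs_tsum_le_tsum_of_abs_le`; the Tonelli bound `tsum_tsum_le_of_nonneg` on ℤ³ × ℤ³ (a non-negative double
  series whose inner sums are dominated by a summable function may be summed in either order, and is bounded by the dominant).
* §2 DEFINITIONS (model-free, two-variable kernels `K(x,y)` on ξℤ³): `dK2` = `(K∂^{ξ*}_μ)(x,y) = ξ^{−1}(K(x,y+e_μ) − K(x,y))`,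
  `dK1` = `(∂^ξ_μK)(x,y) = ξ^{−1}(K(x+e_μ,y) − K(x,y))`, `d2K` = `(∂^ξ_{μ′}K∂^{ξ*}_μ)(x,y)` (the kernels entering (3.26)), and their
  values on convolution kernels `K(x,y) = C(x − y)` (`dK2_conv`, `d2K_conv`: r15's `pdiffAdjZ`, `pdiffZ ∘ pdiffAdjZ`).
* §3 **`exists_laws`** — ONE RATE `0 < δ ≤ ½` AND ONE CONSTANT for all the kernel laws used downstream: `G^ξ_k(0)` (value `P₁`,
  both first differences `P₂`, mixed second difference `P₃` — `B3GkZeroLatticePointwise`), the middle factor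
  `G^ξ(1 − m² − aP)` (value `P₁`, first difference `P₂` — `B3Eq316ResolventZeroLattice`), and `C^ξ` (value `P₁`, `∂^{ξ*}C^ξ`,
  `∂^ξC^ξ` `P₂` — `B3CxiLatticePairSums`).
* §4 **THE DIFFERENCE KERNEL IS UNIFORMLY BOUNDED**: `exists_MxiL_bound`: `|M(y,y′)| ≤ C₀` for all `y, y′`, `k ≥ 1`, window
  (AM–GM pair sum `B3ZdKernelConvolutions.tsum_profile_one_mul_le`) — whereas `G^ξ(y,y) ~ ξ^{−1}`: the point of (3.16).
* §5 **ITS DIFFERENCES ARE CONVOLUTIONS**: `dK2_MxiL` (`(M∂^{ξ*}_{μ′})(y,x′) = Σ'_z ξ³[G^ξ(1−m²−aP)](y,z)(∂^{ξ*}_{μ′}C^ξ)(z−x′)`,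
  absolutely convergent, `|·| ≤ C₁ξ^{−1}`), `d2K_MxiL` (`(∂^ξ_{μ′}M∂^{ξ*}_μ)(x,y) = Σ'_z ξ³(∂^ξ_{μ′}[G^ξ(1−m²−aP)])(x,z)
  (∂^{ξ*}_μC^ξ)(z−y)`) and **`abs_d2K_MxiL_le`**: `|(∂_{μ′}M∂^*_μ)(x,y)| ≤ C₂·P₁^{δ/2}(x−y)` — a once-differentiated-propagator law
  for a twice-differentiated kernel, by the sharp composition `B3ZdKernelConvolutions.conv22_le₂`.
* §6 **THE FUBINI BOUND** `fubini_bound`: for every `κ` with `|κ(x′)| ≤ b·P₂^δ(x′−y)` (the law of a once-differentiated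
  propagator — `G^ξ∂^*`, `C^ξ∂^*` or `M∂^*`), `x′ ↦ ξ³(M∂^{ξ*}_{μ′})(y,x′)κ(x′)` is summable and `|Σ'_{x′} ξ³(M∂^*_{μ′})(y,x′)κ(x′)| ≤
  K·b` uniformly in `k`: the `x′`-sum is performed first inside the convolution defining `M∂^*` (`conv22_le₂`), then the
  `z`-sum (`tsum_profile_one_mul_le`); the exchange is the Tonelli bound of §1.  This is the mechanism of p. 441's *"then we
  get a convergent expression"* for the cross terms of (3.26) with the differentiated leg on `M`.  `fubini_bound_transposed_of_laws`:
  the same for `(∂_μM)(y,·)` (`hasSum_dK1_MxiL`) against `|κ| ≤ b·P₁^δ` (the weighted legs of Π_{μμ′ν}), by AM–GM twice.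
* §7 `exists_bounds`: everything at once, one rate `δ`, one set of constants.
HONEST SCOPE: zero external field, `d = 3`, unit blocks, forward lattice differences along the axes, constants existential;
nothing here is specific to the torus (gens 5–8 of this seat) — every sum is over ℤ³.  Mathlib + the cited tree files only;
definitions with bodies and theorems, no named facts; standard axioms.  Unit `lit-balaban-p39-g9` (Phase-2 proof seat p39,
gen 9), HOME `run/shared/lean/pub/lit-balaban/`, 2026-08-22.
-/

open scoped BigOperators
open Finset Filter Topology

namespace Literature.MathematicalPhysics.QuantumFieldTheory.Balaban1983to89.B3Eq316DifferenceKernelBounds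

open B3Sect3VectorSelfEnergy B3CxiUniformBound B3ZdLatticeProfileSums B3ZdKernelConvolutions B3Eq316ResolventZeroLattice
open B3CxiPropagator (summable_Cxi Cxi_nonneg)
open B3CxiLatticePairSums (abs_Cxi_le_profile abs_pdiffAdjZ_Cxi_le_profile abs_pdiffZ_Cxi_le_profile profile_shift_le
  supNorm_unitVec)
open B3GkZeroLattice (GkLat GkLat_comm)
open B3GkZeroLatticePointwise (abs_GkLatMixed_profile)

noncomputable section

/-! ## §1 Model-free summation lemmas -/

section ModelFree

/-- kernel: `|Σ' f| ≤ Σ' g` when `|f| ≤ g` pointwise and both are summable. [cite: Balaban1983Higgs3, (3.16) p.437] -/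
theorem abs_tsum_le_tsum_of_abs_le {f g : ZSite 3 → ℝ} (hf : Summable f) (hg : Summable g) (h : ∀ z, |f z| ≤ g z) :
    |∑' z, f z| ≤ ∑' z, g z := by
  rw [abs_le]
  constructor
  · rw [← tsum_neg]
    exact hg.neg.tsum_le_tsum (fun z => (abs_le.1 (h z)).1) hf
  · exact hf.tsum_le_tsum (fun z => (abs_le.1 (h z)).2) hg

/-- **Tonelli bound on ℤ³ × ℤ³**: a non-negative double sequence `F(z,x)` whose `x`-sums are dominated by a summable `H(z)` is
summable in `x` for each `z`… and, exchanged, `x ↦ Σ'_z F(z,x)` is summable with `Σ'_x Σ'_z F(z,x) ≤ Σ'_z H(z)`.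
[cite: Balaban1983Higgs3, (3.16) p.437] -/
theorem tsum_tsum_le_of_nonneg {F : ZSite 3 → ZSite 3 → ℝ} {H : ZSite 3 → ℝ} (hF0 : ∀ z x, 0 ≤ F z x)
    (hFz : ∀ z, Summable (F z)) (hFH : ∀ z, ∑' x, F z x ≤ H z) (hH : Summable H) :
    (∀ x, Summable fun z => F z x) ∧ Summable (fun x => ∑' z, F z x) ∧ ∑' x, ∑' z, F z x ≤ ∑' z, H z := by
  have hsz : Summable fun z => ∑' x, F z x :=
    Summable.of_nonneg_of_le (fun z => tsum_nonneg (hF0 z)) hFH hH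
  have hU : Summable (Function.uncurry F) :=
    (summable_prod_of_nonneg (fun p => hF0 p.1 p.2)).2 ⟨hFz, hsz⟩
  have hU' : Summable (fun p : ZSite 3 × ZSite 3 => F p.2 p.1) := hU.prod_symm
  obtain ⟨hFx, hsx⟩ := (summable_prod_of_nonneg (f := fun p : ZSite 3 × ZSite 3 => F p.2 p.1)
    (fun p => hF0 p.2 p.1)).1 hU'
  refine ⟨hFx, hsx, ?_⟩
  rw [hU.tsum_comm' hFz hFx]
  exact hsz.tsum_le_tsum hFH hH

end ModelFree

/-! ## §2 Kernel differences on ξℤ³ and the profile -/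

/-- the profile `P_q^δ(u) = (ξ·max(1,|u|_∞))^{−q}·e^{−δξ|u|_∞}` of `B3ZdLatticeProfileSums` (a name for the recurring expression).
[cite: Balaban1983Higgs3, (3.16) p.437] -/
def prof (ξ δ : ℝ) (q : ℕ) (u : ZSite 3) : ℝ :=
  ((ξ * max 1 (supNorm u : ℝ)) ^ q)⁻¹ * Real.exp (-(δ * (ξ * (supNorm u : ℝ))))

/-- `(K∂^{ξ*}_μ)(x,y) = ξ^{−1}(K(x, y+e_μ) − K(x,y))` — the kernel of `K∘∂^{ξ*}_μ` for a two-variable kernel on ξℤ³ (r15's torus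
`dAdjKernel`; on convolution kernels p20's `pdiffAdjZ`). [cite: Balaban1983Higgs3, (3.26) p.440] -/
def dK2 (ξ : ℝ) (μ : Fin 3) (K : ZSite 3 → ZSite 3 → ℝ) (x y : ZSite 3) : ℝ := ξ⁻¹ * (K x (y + unitVec μ) - K x y)

/-- `(∂^ξ_μK)(x,y) = ξ^{−1}(K(x+e_μ, y) − K(x,y))` — forward difference in the first variable. [cite: Balaban1983Higgs3, (3.26) p.440] -/
def dK1 (ξ : ℝ) (μ : Fin 3) (K : ZSite 3 → ZSite 3 → ℝ) (x y : ZSite 3) : ℝ := ξ⁻¹ * (K (x + unitVec μ) y - K x y)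

/-- `(∂^ξ_{μ′}K∂^{ξ*}_μ)(x,y) = ξ^{−2}[K(x+e_{μ′},y+e_μ) − K(x+e_{μ′},y) − K(x,y+e_μ) + K(x,y)]` — the mixed second-difference kernel
of (3.26) (r15's torus `d2Kernel`). [cite: Balaban1983Higgs3, (3.26) p.440] -/
def d2K (ξ : ℝ) (μ' μ : Fin 3) (K : ZSite 3 → ZSite 3 → ℝ) (x y : ZSite 3) : ℝ :=
  ξ⁻¹ ^ 2 * (K (x + unitVec μ') (y + unitVec μ) - K (x + unitVec μ') y - K x (y + unitVec μ) + K x y)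

section Defs

variable {ξ : ℝ}

/-- kernel: the profile is non-negative. [cite: Balaban1983Higgs3, (3.16) p.437] -/
theorem prof_nonneg (hξ : 0 ≤ ξ) (δ : ℝ) (q : ℕ) (u : ZSite 3) : 0 ≤ prof ξ δ q u := by unfold prof; positivity

/-- kernel: the profile is symmetric. [cite: Balaban1983Higgs3, (3.16) p.437] -/
theorem prof_sub_comm (ξ δ : ℝ) (q : ℕ) (u v : ZSite 3) : prof ξ δ q (u - v) = prof ξ δ q (v - u) := by
  unfold prof; rw [← supNorm_neg, neg_sub]

/-- kernel: weakening the rate. [cite: Balaban1983Higgs3, (3.16) p.437] -/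
theorem prof_mono_rate (hξ : 0 ≤ ξ) {δ δ' : ℝ} (h : δ' ≤ δ) (q : ℕ) (u : ZSite 3) : prof ξ δ q u ≤ prof ξ δ' q u :=
  profile_mono_rate hξ h q u

/-- kernel: `P_{q+1} ≤ ξ^{−1}P_q`. [cite: Balaban1983Higgs3, (3.16) p.437] -/
theorem prof_succ_le (hξ : 0 < ξ) (δ : ℝ) (q : ℕ) (u : ZSite 3) : prof ξ δ (q + 1) u ≤ ξ⁻¹ * prof ξ δ q u :=
  profile_succ_le_inv_mul hξ q δ u

/-- kernel: a unit shift costs at most the factor `2^q·e`. [cite: Balaban1983Higgs3, (3.16) p.437] -/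
theorem prof_shift_le (hξ : 0 < ξ) (hξ1 : ξ ≤ 1) {δ : ℝ} (hδ : 0 ≤ δ) (hδ1 : δ ≤ 1) (q : ℕ) (u s : ZSite 3)
    (hs : supNorm s ≤ 1) : prof ξ δ q (u + s) ≤ 2 ^ q * Real.exp 1 * prof ξ δ q u :=
  profile_shift_le hξ hξ1 hδ hδ1 q u s hs

/-- `K∂^{ξ*}` of a convolution kernel is the convolution kernel of `∂^{ξ*}C`. [cite: Balaban1983Higgs3, (3.26) p.440] -/
theorem dK2_conv (ξ : ℝ) (μ : Fin 3) (C : ZSite 3 → ℝ) (x y : ZSite 3) :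
    dK2 ξ μ (fun a b => C (a - b)) x y = pdiffAdjZ ξ⁻¹ μ C (x - y) := by
  unfold dK2 pdiffAdjZ
  simp only [sub_add_eq_sub_sub]

/-- `∂^ξK∂^{ξ*}` of a convolution kernel. [cite: Balaban1983Higgs3, (3.26) p.440] -/
theorem d2K_conv (ξ : ℝ) (μ' μ : Fin 3) (C : ZSite 3 → ℝ) (x y : ZSite 3) :
    d2K ξ μ' μ (fun a b => C (a - b)) x y = pdiffZ ξ⁻¹ μ' (pdiffAdjZ ξ⁻¹ μ C) (x - y) := by
  unfold d2K pdiffZ pdiffAdjZ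
  simp only [show x + unitVec μ' - (y + unitVec μ) = x - y + unitVec μ' - unitVec μ by abel,
    show x + unitVec μ' - y = x - y + unitVec μ' by abel, sub_add_eq_sub_sub x y (unitVec μ)]
  ring

/-- `d2K` is the first difference of `dK2`. [cite: Balaban1983Higgs3, (3.26) p.440] -/
theorem d2K_eq_dK1_dK2 (ξ : ℝ) (μ' μ : Fin 3) (K : ZSite 3 → ZSite 3 → ℝ) (x y : ZSite 3) :
    d2K ξ μ' μ K x y = dK1 ξ μ' (dK2 ξ μ K) x y := by
  unfold d2K dK1 dK2; ring

end Defs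

/-! ## §3 One rate and one constant for all the kernel laws -/

section Laws

variable {ℓ : ℕ}

/-- **THE KERNEL LAWS OF p. 437 WITH ONE RATE AND ONE CONSTANT**: there are `0 < δ ≤ ½` and `C > 0` (functions of `L` and the
window) such that for every `k ≥ 1` and `(a, m²)` in the window, with `ξ = L^{−k}`, `G = G^ξ_k(0)`, `S = G(1 − m² − a_kP_k)`:
`|G(y,z)| ≤ C P₁^δ(y−z)`, `|(∂_μG)(y,z)|, |(G∂^*_μ)(y,z)| ≤ C P₂^δ(y−z)`, `|(∂_{μ′}G∂^*_μ)(x,y)| ≤ C P₃^δ(x−y)`, `|S(y,z)| ≤ C P₁^δ`,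
`|(∂_μS)(y,z)| ≤ C P₂^δ`, `|C^ξ(u)| ≤ C P₁^δ(u)`, `|(∂^{ξ*}_μC^ξ)(u)|, |(∂^ξ_μC^ξ)(u)| ≤ C P₂^δ(u)`. [cite: Balaban1983Higgs3, (3.16) p.437] -/
theorem exists_laws (hℓ : 1 ≤ ℓ) (amin aplus m2plus : ℝ) (ha : 0 < amin) :
    ∃ δ C : ℝ, 0 < δ ∧ δ ≤ 1 / 2 ∧ 1 ≤ C ∧ ∀ (k : ℕ), 1 ≤ k → ∀ (a m2 : ℝ), amin ≤ a → a ≤ aplus → 0 ≤ m2 → m2 ≤ m2plus →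
      (∀ y z : ZSite 3, |GxiL ℓ k a m2 y z| ≤ C * prof (xiOf ℓ k) δ 1 (y - z)) ∧
      (∀ (μ : Fin 3) (y z : ZSite 3), |dK1 (xiOf ℓ k) μ (GxiL ℓ k a m2) y z| ≤ C * prof (xiOf ℓ k) δ 2 (y - z)) ∧
      (∀ (μ : Fin 3) (y z : ZSite 3), |dK2 (xiOf ℓ k) μ (GxiL ℓ k a m2) y z| ≤ C * prof (xiOf ℓ k) δ 2 (y - z)) ∧
      (∀ (μ' μ : Fin 3) (x y : ZSite 3), |d2K (xiOf ℓ k) μ' μ (GxiL ℓ k a m2) x y| ≤ C * prof (xiOf ℓ k) δ 3 (x - y)) ∧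
      (∀ y z : ZSite 3, |smearG ℓ k a m2 y z| ≤ C * prof (xiOf ℓ k) δ 1 (y - z)) ∧
      (∀ (μ : Fin 3) (y z : ZSite 3), |dK1 (xiOf ℓ k) μ (smearG ℓ k a m2) y z| ≤ C * prof (xiOf ℓ k) δ 2 (y - z)) ∧
      (∀ u : ZSite 3, |Cxi 3 (xiOf ℓ k) u| ≤ C * prof (xiOf ℓ k) δ 1 u) ∧
      (∀ (μ : Fin 3) (u : ZSite 3), |pdiffAdjZ (xiOf ℓ k)⁻¹ μ (Cxi 3 (xiOf ℓ k)) u| ≤ C * prof (xiOf ℓ k) δ 2 u) ∧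
      (∀ (μ : Fin 3) (u : ZSite 3), |pdiffZ (xiOf ℓ k)⁻¹ μ (Cxi 3 (xiOf ℓ k)) u| ≤ C * prof (xiOf ℓ k) δ 2 u) := by
  obtain ⟨δG, CG, hδG, hδGh, hCG, hG⟩ := exists_GxiL_profile hℓ amin aplus m2plus ha
  obtain ⟨δS, CS, hδS, hδSh, hCS, hS⟩ := exists_smearG_profile hℓ amin aplus m2plus ha
  obtain ⟨δM, CM, hδM, hCM, hM⟩ := abs_GkLatMixed_profile 2 ℓ hℓ amin aplus m2plus ha
  set δ : ℝ := min (min δG δS) (min δM (1 / 2)) with hδdef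
  set C : ℝ := max (max CG CS) (max CM 900) with hCdef
  have hδpos : 0 < δ := lt_min (lt_min hδG hδS) (lt_min hδM (by norm_num))
  have hδ_G : δ ≤ δG := (min_le_left _ _).trans (min_le_left _ _)
  have hδ_S : δ ≤ δS := (min_le_left _ _).trans (min_le_right _ _)
  have hδ_M : δ ≤ δM := (min_le_right _ _).trans (min_le_left _ _)
  have hδ_h : δ ≤ 1 / 2 := (min_le_right _ _).trans (min_le_right _ _)
  have hC_G : CG ≤ C := (le_max_left _ _).trans (le_max_left _ _)
  have hC_S : CS ≤ C := (le_max_right _ _).trans (le_max_left _ _)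
  have hC_M : CM ≤ C := (le_max_left _ _).trans (le_max_right _ _)
  have hC_9 : (900 : ℝ) ≤ C := (le_max_right _ _).trans (le_max_right _ _)
  have hC1 : (1 : ℝ) ≤ C := le_trans (by norm_num) hC_9
  have hC0 : 0 ≤ C := le_trans (by norm_num) hC1
  refine ⟨δ, C, hδpos, hδ_h, hC1, ?_⟩
  intro k hk a m2 ha1 ha2 hm1 hm2
  obtain ⟨hG1, hG2, hG3⟩ := hG k hk a m2 ha1 ha2 hm1 hm2
  obtain ⟨hS1, hS2⟩ := hS k hk a m2 ha1 ha2 hm1 hm2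
  have hξ : 0 < xiOf ℓ k := xiOf_pos ℓ k
  have hξ1 : xiOf ℓ k ≤ 1 := xiOf_le_one ℓ k
  have hξ0 : 0 ≤ xiOf ℓ k := hξ.le
  -- the generic weakening step
  have weak : ∀ {v C' δ' : ℝ} {q : ℕ} {u : ZSite 3}, v ≤ C' * prof (xiOf ℓ k) δ' q u → C' ≤ C → δ ≤ δ' →
      v ≤ C * prof (xiOf ℓ k) δ q u := by
    intro v C' δ' q u hv hC' hδ'
    refine hv.trans ?_
    calc C' * prof (xiOf ℓ k) δ' q u ≤ C * prof (xiOf ℓ k) δ' q u :=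
          mul_le_mul_of_nonneg_right hC' (prof_nonneg hξ0 _ _ _)
      _ ≤ C * prof (xiOf ℓ k) δ q u := mul_le_mul_of_nonneg_left (prof_mono_rate hξ0 hδ' q u) hC0
  refine ⟨fun y z => weak (hG1 y z) hC_G hδ_G, fun μ y z => ?_, fun μ y z => ?_, fun μ' μ x y => ?_,
    fun y z => weak (hS1 y z) hC_S hδ_S, fun μ y z => ?_, fun u => ?_, fun μ u => ?_, fun μ u => ?_⟩
  · have h := hG2 μ y z
    have e : |dK1 (xiOf ℓ k) μ (GxiL ℓ k a m2) y z| =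
        (xiOf ℓ k)⁻¹ * |GxiL ℓ k a m2 (y + unitVec μ) z - GxiL ℓ k a m2 y z| := by
      rw [dK1, abs_mul, abs_of_pos (inv_pos.2 hξ)]
    rw [e]; exact weak h hC_G hδ_G
  · have h := hG3 μ y z
    have e : |dK2 (xiOf ℓ k) μ (GxiL ℓ k a m2) y z| =
        (xiOf ℓ k)⁻¹ * |GxiL ℓ k a m2 y (z + unitVec μ) - GxiL ℓ k a m2 y z| := by
      rw [dK2, abs_mul, abs_of_pos (inv_pos.2 hξ)]
    rw [e]; exact weak h hC_G hδ_G
  · -- the mixed second difference of `G`, from `B3GkZeroLatticePointwise`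
    have hb := hM k hk a m2 ha1 ha2 hm1 hm2 μ' μ x y
    have hL : ((ℓ : ℝ) + 1) ^ k = (xiOf ℓ k)⁻¹ := Lpow_eq_inv_xiOf ℓ k
    rw [mul_assoc CM, profile_conv ℓ k (2 + 1) δM (x - y), hL] at hb
    have e : |d2K (xiOf ℓ k) μ' μ (GxiL ℓ k a m2) x y| = ((xiOf ℓ k)⁻¹) ^ (2 + 1) * (((xiOf ℓ k)⁻¹) ^ 2 *
        |(GkLat (d := 2) ℓ k a m2 (x + Pi.single μ' 1) (y + Pi.single μ 1) - GkLat (d := 2) ℓ k a m2 x (y + Pi.single μ 1))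
          - (GkLat (d := 2) ℓ k a m2 (x + Pi.single μ' 1) y - GkLat (d := 2) ℓ k a m2 x y)|) := by
      simp only [d2K, GxiL, unitVec, hL]
      rw [show ∀ a b c d : ℝ, (xiOf ℓ k)⁻¹ ^ 2 * ((xiOf ℓ k)⁻¹ ^ 3 * a - (xiOf ℓ k)⁻¹ ^ 3 * b -
          (xiOf ℓ k)⁻¹ ^ 3 * c + (xiOf ℓ k)⁻¹ ^ 3 * d) = ((xiOf ℓ k)⁻¹ ^ 2 * (xiOf ℓ k)⁻¹ ^ 3) * ((a - c) - (b - d))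
        from fun a b c d => by ring, abs_mul, abs_of_pos (by positivity : (0 : ℝ) < (xiOf ℓ k)⁻¹ ^ 2 * (xiOf ℓ k)⁻¹ ^ 3)]
      ring
    rw [e]
    exact weak hb hC_M hδ_M
  · have h := hS2 μ y z
    have e : |dK1 (xiOf ℓ k) μ (smearG ℓ k a m2) y z| =
        (xiOf ℓ k)⁻¹ * |smearG ℓ k a m2 (y + unitVec μ) z - smearG ℓ k a m2 y z| := by
      rw [dK1, abs_mul, abs_of_pos (inv_pos.2 hξ)]
    rw [e]; exact weak h hC_S hδ_S
  · have h := abs_Cxi_le_profile (d := 3) rfl hξ hξ1 u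
    exact weak h ((by norm_num : (140 : ℝ) ≤ 900).trans hC_9) hδ_h
  · exact weak (abs_pdiffAdjZ_Cxi_le_profile (d := 3) rfl hξ hξ1 μ u) hC_9 hδ_h
  · exact weak (abs_pdiffZ_Cxi_le_profile (d := 3) rfl hξ hξ1 μ u) hC_9 hδ_h

end Laws

/-! ## §4 The difference kernel is uniformly bounded -/

section MBounds

variable {ℓ k : ℕ} {a m2 : ℝ}

/-- **`|M(y,y′)| ≤ C²·833/δ³`** given the laws of the middle factor and of `C^ξ` with rate `δ`: the difference kernel of (3.16)
is bounded uniformly in the points and in the spacing (AM–GM pair sum), whereas `G^ξ(y,y) ~ ξ^{−1}`.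
[cite: Balaban1983Higgs3, (3.16) p.437] -/
theorem abs_MxiL_le_of_laws (hℓ : 1 ≤ ℓ) (hk : 1 ≤ k) (ha : 0 < a) (hm : 0 ≤ m2) {δ C : ℝ} (hδ : 0 < δ) (hδ1 : δ ≤ 1)
    (hC : 0 ≤ C) (hS1 : ∀ y z : ZSite 3, |smearG ℓ k a m2 y z| ≤ C * prof (xiOf ℓ k) δ 1 (y - z))
    (hCx : ∀ u : ZSite 3, |Cxi 3 (xiOf ℓ k) u| ≤ C * prof (xiOf ℓ k) δ 1 u) (y y' : ZSite 3) :
    |MxiL ℓ k a m2 y y'| ≤ C * C * (833 / δ ^ 3) := by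
  have hξ := xiOf_pos ℓ k
  obtain ⟨hM, hsum⟩ := MxiL_eq_tsum hℓ hk ha hm y y'
  obtain ⟨hgs, hgle⟩ := tsum_profile_one_mul_le hξ (xiOf_le_one ℓ k) hδ hδ1 y y'
  rw [hM]
  have hpt : ∀ z, |(xiOf ℓ k) ^ 3 * (smearG ℓ k a m2 y z * Cxi 3 (xiOf ℓ k) (z - y'))| ≤
      C * C * ((xiOf ℓ k) ^ 3 * (prof (xiOf ℓ k) δ 1 (y - z) * prof (xiOf ℓ k) δ 1 (z - y'))) := by
    intro z
    rw [abs_mul, abs_mul, abs_of_pos (by positivity : (0 : ℝ) < xiOf ℓ k ^ 3)]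
    have h1 := hS1 y z
    have h2 := hCx (z - y')
    have hp1 := prof_nonneg hξ.le δ 1 (y - z)
    calc (xiOf ℓ k) ^ 3 * (|smearG ℓ k a m2 y z| * |Cxi 3 (xiOf ℓ k) (z - y')|)
        ≤ (xiOf ℓ k) ^ 3 * ((C * prof (xiOf ℓ k) δ 1 (y - z)) * (C * prof (xiOf ℓ k) δ 1 (z - y'))) :=
          mul_le_mul_of_nonneg_left (mul_le_mul h1 h2 (abs_nonneg _) (by positivity)) (by positivity)
      _ = _ := by ring
  refine (abs_tsum_le_tsum_of_abs_le hsum.of_abs (hgs.mul_left (C * C)) hpt).trans ?_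
  rw [tsum_mul_left]
  exact mul_le_mul_of_nonneg_left hgle (by positivity)

/-! ## §5 The differences of `M` are convolutions -/

/-- **`(M∂^{ξ*}_{μ′})(y,x′) = Σ'_z ξ³[G^ξ(1−m²−aP)](y,z)·(∂^{ξ*}_{μ′}C^ξ)(z − x′)`** — the second-variable difference of (3.16)
falls on `C^ξ`. [cite: Balaban1983Higgs3, (3.16) p.437] -/
theorem hasSum_dK2_MxiL (hℓ : 1 ≤ ℓ) (hk : 1 ≤ k) (ha : 0 < a) (hm : 0 ≤ m2) (μ' : Fin 3) (y x' : ZSite 3) :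
    HasSum (fun z => (xiOf ℓ k) ^ 3 * (smearG ℓ k a m2 y z * pdiffAdjZ (xiOf ℓ k)⁻¹ μ' (Cxi 3 (xiOf ℓ k)) (z - x')))
      (dK2 (xiOf ℓ k) μ' (MxiL ℓ k a m2) y x') := by
  have h1 := hasSum_resolvent316 hℓ hk ha hm y (x' + unitVec μ')
  have h0 := hasSum_resolvent316 hℓ hk ha hm y x'
  have h := (h1.sub h0).mul_left ((xiOf ℓ k)⁻¹)
  have e : (fun z => (xiOf ℓ k) ^ 3 * (smearG ℓ k a m2 y z * pdiffAdjZ (xiOf ℓ k)⁻¹ μ' (Cxi 3 (xiOf ℓ k)) (z - x'))) =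
      (fun z => (xiOf ℓ k)⁻¹ * ((xiOf ℓ k) ^ 3 * (smearG ℓ k a m2 y z * Cxi 3 (xiOf ℓ k) (z - (x' + unitVec μ'))) -
        (xiOf ℓ k) ^ 3 * (smearG ℓ k a m2 y z * Cxi 3 (xiOf ℓ k) (z - x')))) := by
    funext z; simp only [pdiffAdjZ, sub_add_eq_sub_sub]; ring
  rw [e]
  exact h

/-- kernel: the summand of `hasSum_dK2_MxiL` is absolutely summable. [cite: Balaban1983Higgs3, (3.16) p.437] -/
theorem summable_abs_dK2_integrand (hℓ : 1 ≤ ℓ) (hk : 1 ≤ k) (ha : 0 < a) (hm : 0 ≤ m2) (μ' : Fin 3) (y x' : ZSite 3) :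
    Summable fun z => |(xiOf ℓ k) ^ 3 * (smearG ℓ k a m2 y z * pdiffAdjZ (xiOf ℓ k)⁻¹ μ' (Cxi 3 (xiOf ℓ k)) (z - x'))| := by
  have hξ := xiOf_pos ℓ k
  -- `∂^{ξ*}C^ξ` is bounded (a difference of two values of the bounded `C^ξ`)
  obtain ⟨B, hB⟩ : ∃ B, ∀ u : ZSite 3, |Cxi 3 (xiOf ℓ k) u| ≤ B :=
    ⟨_, fun u => by
      have h := abs_le_tsum_abs (summable_abs_Cxi_translate hξ 0) u
      simpa using h⟩
  have hb : ∀ z, |pdiffAdjZ (xiOf ℓ k)⁻¹ μ' (Cxi 3 (xiOf ℓ k)) (z - x')| ≤ (xiOf ℓ k)⁻¹ * (B + B) := by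
    intro z
    rw [pdiffAdjZ, abs_mul, abs_of_pos (inv_pos.2 hξ)]
    exact mul_le_mul_of_nonneg_left ((abs_sub _ _).trans (add_le_add (hB _) (hB _))) (by positivity)
  have h := (summable_abs_mul_of_bdd (summable_abs_smearG hℓ hk ha hm y) hb).mul_left (|(xiOf ℓ k) ^ 3|)
  refine h.congr fun z => ?_
  exact (abs_mul _ _).symm

/-- **`|(M∂^{ξ*}_{μ′})(y,x′)| ≤ C²ξ^{−1}·833/δ³`** (a crude uniform bound: the summand is `≤ ξ³·CP₁·Cξ^{−1}P₁`); used only for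
summability. [cite: Balaban1983Higgs3, (3.16) p.437] -/
theorem abs_dK2_MxiL_le_unif (hℓ : 1 ≤ ℓ) (hk : 1 ≤ k) (ha : 0 < a) (hm : 0 ≤ m2) {δ C : ℝ} (hδ : 0 < δ) (hδ1 : δ ≤ 1)
    (hC : 0 ≤ C) (hS1 : ∀ y z : ZSite 3, |smearG ℓ k a m2 y z| ≤ C * prof (xiOf ℓ k) δ 1 (y - z))
    (hCa : ∀ (μ : Fin 3) (u : ZSite 3), |pdiffAdjZ (xiOf ℓ k)⁻¹ μ (Cxi 3 (xiOf ℓ k)) u| ≤ C * prof (xiOf ℓ k) δ 2 u)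
    (μ' : Fin 3) (y x' : ZSite 3) :
    |dK2 (xiOf ℓ k) μ' (MxiL ℓ k a m2) y x'| ≤ (xiOf ℓ k)⁻¹ * (C * C * (833 / δ ^ 3)) := by
  have hξ := xiOf_pos ℓ k
  rw [← (hasSum_dK2_MxiL hℓ hk ha hm μ' y x').tsum_eq]
  obtain ⟨hgs, hgle⟩ := tsum_profile_one_mul_le hξ (xiOf_le_one ℓ k) hδ hδ1 y x'
  have hpt : ∀ z, |(xiOf ℓ k) ^ 3 * (smearG ℓ k a m2 y z * pdiffAdjZ (xiOf ℓ k)⁻¹ μ' (Cxi 3 (xiOf ℓ k)) (z - x'))| ≤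
      (xiOf ℓ k)⁻¹ * (C * C) * ((xiOf ℓ k) ^ 3 * (prof (xiOf ℓ k) δ 1 (y - z) * prof (xiOf ℓ k) δ 1 (z - x'))) := by
    intro z
    rw [abs_mul, abs_mul, abs_of_pos (by positivity : (0 : ℝ) < xiOf ℓ k ^ 3)]
    have h1 := hS1 y z
    have h2 : |pdiffAdjZ (xiOf ℓ k)⁻¹ μ' (Cxi 3 (xiOf ℓ k)) (z - x')| ≤ C * ((xiOf ℓ k)⁻¹ * prof (xiOf ℓ k) δ 1 (z - x')) :=
      (hCa μ' (z - x')).trans (mul_le_mul_of_nonneg_left (prof_succ_le hξ δ 1 (z - x')) hC)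
    have hp1 := prof_nonneg hξ.le δ 1 (y - z)
    calc (xiOf ℓ k) ^ 3 * (|smearG ℓ k a m2 y z| * |pdiffAdjZ (xiOf ℓ k)⁻¹ μ' (Cxi 3 (xiOf ℓ k)) (z - x')|)
        ≤ (xiOf ℓ k) ^ 3 * ((C * prof (xiOf ℓ k) δ 1 (y - z)) * (C * ((xiOf ℓ k)⁻¹ * prof (xiOf ℓ k) δ 1 (z - x')))) :=
          mul_le_mul_of_nonneg_left (mul_le_mul h1 h2 (abs_nonneg _) (by positivity)) (by positivity)
      _ = _ := by ring
  refine (abs_tsum_le_tsum_of_abs_le (summable_abs_dK2_integrand hℓ hk ha hm μ' y x').of_abs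
    (hgs.mul_left ((xiOf ℓ k)⁻¹ * (C * C))) hpt).trans ?_
  rw [tsum_mul_left, mul_assoc]
  exact mul_le_mul_of_nonneg_left (mul_le_mul_of_nonneg_left hgle (by positivity)) (by positivity)

/-- **`(∂^ξ_{μ′}M∂^{ξ*}_μ)(x,y) = Σ'_z ξ³(∂^ξ_{μ′}[G^ξ(1−m²−aP)])(x,z)·(∂^{ξ*}_μC^ξ)(z − y)`** — one difference on each factor.
[cite: Balaban1983Higgs3, (3.16) p.437] -/
theorem hasSum_d2K_MxiL (hℓ : 1 ≤ ℓ) (hk : 1 ≤ k) (ha : 0 < a) (hm : 0 ≤ m2) (μ' μ : Fin 3) (x y : ZSite 3) :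
    HasSum (fun z => (xiOf ℓ k) ^ 3 *
        (dK1 (xiOf ℓ k) μ' (smearG ℓ k a m2) x z * pdiffAdjZ (xiOf ℓ k)⁻¹ μ (Cxi 3 (xiOf ℓ k)) (z - y)))
      (d2K (xiOf ℓ k) μ' μ (MxiL ℓ k a m2) x y) := by
  have h11 := hasSum_resolvent316 hℓ hk ha hm (x + unitVec μ') (y + unitVec μ)
  have h10 := hasSum_resolvent316 hℓ hk ha hm (x + unitVec μ') y
  have h01 := hasSum_resolvent316 hℓ hk ha hm x (y + unitVec μ)
  have h00 := hasSum_resolvent316 hℓ hk ha hm x y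
  have h := ((h11.sub h10).sub (h01.sub h00)).mul_left ((xiOf ℓ k)⁻¹ ^ 2)
  have e : (fun z => (xiOf ℓ k) ^ 3 *
        (dK1 (xiOf ℓ k) μ' (smearG ℓ k a m2) x z * pdiffAdjZ (xiOf ℓ k)⁻¹ μ (Cxi 3 (xiOf ℓ k)) (z - y))) =
      (fun z => (xiOf ℓ k)⁻¹ ^ 2 *
        ((xiOf ℓ k) ^ 3 * (smearG ℓ k a m2 (x + unitVec μ') z * Cxi 3 (xiOf ℓ k) (z - (y + unitVec μ))) -
          (xiOf ℓ k) ^ 3 * (smearG ℓ k a m2 (x + unitVec μ') z * Cxi 3 (xiOf ℓ k) (z - y)) -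
         ((xiOf ℓ k) ^ 3 * (smearG ℓ k a m2 x z * Cxi 3 (xiOf ℓ k) (z - (y + unitVec μ))) -
          (xiOf ℓ k) ^ 3 * (smearG ℓ k a m2 x z * Cxi 3 (xiOf ℓ k) (z - y))))) := by
    funext z; simp only [dK1, pdiffAdjZ, sub_add_eq_sub_sub]; ring
  rw [e]
  have ev : d2K (xiOf ℓ k) μ' μ (MxiL ℓ k a m2) x y = (xiOf ℓ k)⁻¹ ^ 2 *
      (MxiL ℓ k a m2 (x + unitVec μ') (y + unitVec μ) - MxiL ℓ k a m2 (x + unitVec μ') y -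
        (MxiL ℓ k a m2 x (y + unitVec μ) - MxiL ℓ k a m2 x y)) := by
    rw [d2K]; ring
  rw [ev]
  exact h

/-- kernel: the summand of `hasSum_d2K_MxiL` is absolutely summable. [cite: Balaban1983Higgs3, (3.16) p.437] -/
theorem summable_abs_d2K_integrand (hℓ : 1 ≤ ℓ) (hk : 1 ≤ k) (ha : 0 < a) (hm : 0 ≤ m2) (μ' μ : Fin 3) (x y : ZSite 3) :
    Summable fun z => |(xiOf ℓ k) ^ 3 *
      (dK1 (xiOf ℓ k) μ' (smearG ℓ k a m2) x z * pdiffAdjZ (xiOf ℓ k)⁻¹ μ (Cxi 3 (xiOf ℓ k)) (z - y))| := by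
  have hξ := xiOf_pos ℓ k
  obtain ⟨B, hB⟩ : ∃ B, ∀ u : ZSite 3, |Cxi 3 (xiOf ℓ k) u| ≤ B :=
    ⟨_, fun u => by
      have h := abs_le_tsum_abs (summable_abs_Cxi_translate hξ 0) u
      simpa using h⟩
  have hb : ∀ z, |pdiffAdjZ (xiOf ℓ k)⁻¹ μ (Cxi 3 (xiOf ℓ k)) (z - y)| ≤ (xiOf ℓ k)⁻¹ * (B + B) := by
    intro z
    rw [pdiffAdjZ, abs_mul, abs_of_pos (inv_pos.2 hξ)]
    exact mul_le_mul_of_nonneg_left ((abs_sub _ _).trans (add_le_add (hB _) (hB _))) (by positivity)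
  have hS : Summable fun z => |dK1 (xiOf ℓ k) μ' (smearG ℓ k a m2) x z| := by
    have h := ((summable_abs_smearG hℓ hk ha hm (x + unitVec μ')).add (summable_abs_smearG hℓ hk ha hm x)).mul_left
      ((xiOf ℓ k)⁻¹)
    refine Summable.of_nonneg_of_le (fun z => abs_nonneg _) (fun z => ?_) h
    rw [dK1, abs_mul, abs_of_pos (inv_pos.2 hξ)]
    exact mul_le_mul_of_nonneg_left (abs_sub _ _) (by positivity)
  have h := (summable_abs_mul_of_bdd hS hb).mul_left (|(xiOf ℓ k) ^ 3|)
  refine h.congr fun z => ?_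
  exact (abs_mul _ _).symm

/-- **`(∂^ξ_μM)(y,y′) = Σ'_z ξ³(∂^ξ_μ[G^ξ(1−m²−aP)])(y,z)·C^ξ(z − y′)`** — the first-variable difference of (3.16) falls on
the middle factor (the transposed form, used when the weight of Π_{μμ′ν} sits on the `C^ξ` leg). [cite: Balaban1983Higgs3, (3.16) p.437] -/
theorem hasSum_dK1_MxiL (hℓ : 1 ≤ ℓ) (hk : 1 ≤ k) (ha : 0 < a) (hm : 0 ≤ m2) (μ : Fin 3) (y y' : ZSite 3) :
    HasSum (fun z => (xiOf ℓ k) ^ 3 * (dK1 (xiOf ℓ k) μ (smearG ℓ k a m2) y z * Cxi 3 (xiOf ℓ k) (z - y')))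
      (dK1 (xiOf ℓ k) μ (MxiL ℓ k a m2) y y') := by
  have h1 := hasSum_resolvent316 hℓ hk ha hm (y + unitVec μ) y'
  have h0 := hasSum_resolvent316 hℓ hk ha hm y y'
  have h := (h1.sub h0).mul_left ((xiOf ℓ k)⁻¹)
  have e : (fun z => (xiOf ℓ k) ^ 3 * (dK1 (xiOf ℓ k) μ (smearG ℓ k a m2) y z * Cxi 3 (xiOf ℓ k) (z - y'))) =
      (fun z => (xiOf ℓ k)⁻¹ * ((xiOf ℓ k) ^ 3 * (smearG ℓ k a m2 (y + unitVec μ) z * Cxi 3 (xiOf ℓ k) (z - y')) -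
        (xiOf ℓ k) ^ 3 * (smearG ℓ k a m2 y z * Cxi 3 (xiOf ℓ k) (z - y')))) := by
    funext z; simp only [dK1]; ring
  rw [e]
  exact h

/-- kernel: the summand of `hasSum_dK1_MxiL` is absolutely summable. [cite: Balaban1983Higgs3, (3.16) p.437] -/
theorem summable_abs_dK1_integrand (hℓ : 1 ≤ ℓ) (hk : 1 ≤ k) (ha : 0 < a) (hm : 0 ≤ m2) (μ : Fin 3) (y y' : ZSite 3) :
    Summable fun z => |(xiOf ℓ k) ^ 3 * (dK1 (xiOf ℓ k) μ (smearG ℓ k a m2) y z * Cxi 3 (xiOf ℓ k) (z - y'))| := by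
  have hξ := xiOf_pos ℓ k
  obtain ⟨B, hB⟩ : ∃ B, ∀ z : ZSite 3, |Cxi 3 (xiOf ℓ k) (z - y')| ≤ B :=
    ⟨_, abs_le_tsum_abs (summable_abs_Cxi_translate hξ y')⟩
  have hS : Summable fun z => |dK1 (xiOf ℓ k) μ (smearG ℓ k a m2) y z| := by
    have h := ((summable_abs_smearG hℓ hk ha hm (y + unitVec μ)).add (summable_abs_smearG hℓ hk ha hm y)).mul_left
      ((xiOf ℓ k)⁻¹)
    refine Summable.of_nonneg_of_le (fun z => abs_nonneg _) (fun z => ?_) h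
    rw [dK1, abs_mul, abs_of_pos (inv_pos.2 hξ)]
    exact mul_le_mul_of_nonneg_left (abs_sub _ _) (by positivity)
  have h := (summable_abs_mul_of_bdd hS hB).mul_left (|(xiOf ℓ k) ^ 3|)
  refine h.congr fun z => ?_
  exact (abs_mul _ _).symm

/-- **`|(∂^ξ_{μ′}M∂^{ξ*}_μ)(x,y)| ≤ C²·1400·P₁^{δ/2}(x − y)`** given the laws with rate `δ`: the twice-differentiated
difference kernel obeys the law of a ONCE-differentiated propagator — the composition of two `P₂`-kernels is a `P₁`-kernel
(`B3ZdKernelConvolutions.conv22_le₂`), uniformly in the spacing.  This is what makes the `[C^ξ, M]` cross term of (3.26)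
converge. [cite: Balaban1983Higgs3, (3.16) p.437] -/
theorem abs_d2K_MxiL_le_of_laws (hℓ : 1 ≤ ℓ) (hk : 1 ≤ k) (ha : 0 < a) (hm : 0 ≤ m2) {δ C : ℝ} (hδ : 0 < δ)
    (hC : 0 ≤ C) (hS2 : ∀ (μ : Fin 3) (y z : ZSite 3), |dK1 (xiOf ℓ k) μ (smearG ℓ k a m2) y z| ≤
      C * prof (xiOf ℓ k) δ 2 (y - z))
    (hCa : ∀ (μ : Fin 3) (u : ZSite 3), |pdiffAdjZ (xiOf ℓ k)⁻¹ μ (Cxi 3 (xiOf ℓ k)) u| ≤ C * prof (xiOf ℓ k) δ 2 u)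
    (μ' μ : Fin 3) (x y : ZSite 3) :
    |d2K (xiOf ℓ k) μ' μ (MxiL ℓ k a m2) x y| ≤ C * C * 1400 * prof (xiOf ℓ k) (δ / 2) 1 (x - y) := by
  have hξ := xiOf_pos ℓ k
  rw [← (hasSum_d2K_MxiL hℓ hk ha hm μ' μ x y).tsum_eq]
  obtain ⟨hgs, hgle⟩ := conv22_le₂ hξ hδ x y
  have hpt : ∀ z, |(xiOf ℓ k) ^ 3 *
      (dK1 (xiOf ℓ k) μ' (smearG ℓ k a m2) x z * pdiffAdjZ (xiOf ℓ k)⁻¹ μ (Cxi 3 (xiOf ℓ k)) (z - y))| ≤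
      C * C * ((xiOf ℓ k) ^ 3 * (prof (xiOf ℓ k) δ 2 (x - z) * prof (xiOf ℓ k) δ 2 (z - y))) := by
    intro z
    rw [abs_mul, abs_mul, abs_of_pos (by positivity : (0 : ℝ) < xiOf ℓ k ^ 3)]
    have hp := prof_nonneg hξ.le δ 2 (x - z)
    calc (xiOf ℓ k) ^ 3 * (|dK1 (xiOf ℓ k) μ' (smearG ℓ k a m2) x z| * |pdiffAdjZ (xiOf ℓ k)⁻¹ μ (Cxi 3 (xiOf ℓ k)) (z - y)|)
        ≤ (xiOf ℓ k) ^ 3 * ((C * prof (xiOf ℓ k) δ 2 (x - z)) * (C * prof (xiOf ℓ k) δ 2 (z - y))) :=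
          mul_le_mul_of_nonneg_left (mul_le_mul (hS2 μ' x z) (hCa μ (z - y)) (abs_nonneg _) (by positivity))
            (by positivity)
      _ = _ := by ring
  refine (abs_tsum_le_tsum_of_abs_le (summable_abs_d2K_integrand hℓ hk ha hm μ' μ x y).of_abs
    (hgs.mul_left (C * C)) hpt).trans ?_
  rw [tsum_mul_left, show C * C * 1400 * prof (xiOf ℓ k) (δ / 2) 1 (x - y) =
    C * C * (1400 * prof (xiOf ℓ k) (δ / 2) 1 (x - y)) by ring]
  refine mul_le_mul_of_nonneg_left (hgle.trans_eq ?_) (by positivity)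
  rw [prof, pow_one]

/-! ## §6 The Fubini bound -/

/-- **THE FUBINI BOUND**: given the laws with rate `δ` and any `κ` with `|κ(x′)| ≤ b·P₂^δ(x′ − y)`,
`x′ ↦ ξ³(M∂^{ξ*}_{μ′})(y,x′)κ(x′)` is summable and `|Σ'_{x′} ξ³(M∂^{ξ*}_{μ′})(y,x′)κ(x′)| ≤ C²·b·(1400·833·8/δ³)`: inside the
convolution `M∂^* = Σ_z [G(1−m²−aP)](y,z)(∂^*C^ξ)(z−x′)` the `x′`-sum is done first (`(P₂ ⋆ P₂)(z−y) ≤ 1400P₁^{δ/2}(z−y)`,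
`conv22_le₂`), then the `z`-sum (`Σ_z ξ³P₁(y−z)P₁(z−y) ≤ 833/(δ/2)³`); the exchange is Tonelli (`tsum_tsum_le_of_nonneg`).
[cite: Balaban1983Higgs3, (3.16) p.437] -/
theorem fubini_bound_of_laws (hℓ : 1 ≤ ℓ) (hk : 1 ≤ k) (ha : 0 < a) (hm : 0 ≤ m2) {δ C : ℝ} (hδ : 0 < δ) (hδ1 : δ ≤ 1)
    (hC : 0 ≤ C) (hS1 : ∀ y z : ZSite 3, |smearG ℓ k a m2 y z| ≤ C * prof (xiOf ℓ k) δ 1 (y - z))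
    (hCa : ∀ (μ : Fin 3) (u : ZSite 3), |pdiffAdjZ (xiOf ℓ k)⁻¹ μ (Cxi 3 (xiOf ℓ k)) u| ≤ C * prof (xiOf ℓ k) δ 2 u)
    (μ' : Fin 3) (y : ZSite 3) {κ : ZSite 3 → ℝ} {b : ℝ} (hb : 0 ≤ b)
    (hκ : ∀ x', |κ x'| ≤ b * prof (xiOf ℓ k) δ 2 (x' - y)) :
    Summable (fun x' => (xiOf ℓ k) ^ 3 * (dK2 (xiOf ℓ k) μ' (MxiL ℓ k a m2) y x' * κ x')) ∧
      |∑' x', (xiOf ℓ k) ^ 3 * (dK2 (xiOf ℓ k) μ' (MxiL ℓ k a m2) y x' * κ x')| ≤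
        C * C * b * (1400 * (833 / (δ / 2) ^ 3)) := by
  have hξ := xiOf_pos ℓ k
  have hξ1 := xiOf_le_one ℓ k
  set ξ : ℝ := xiOf ℓ k with hξdef
  -- the dominating double sequence
  set F : ZSite 3 → ZSite 3 → ℝ := fun z x' =>
    (C * C * b) * ((ξ ^ 3 * prof ξ δ 1 (y - z)) * (ξ ^ 3 * (prof ξ δ 2 (z - x') * prof ξ δ 2 (x' - y)))) with hF
  have hF0 : ∀ z x', 0 ≤ F z x' := fun z x' => by
    simp only [hF]
    have := prof_nonneg hξ.le δ 1 (y - z); have := prof_nonneg hξ.le δ 2 (z - x')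
    have := prof_nonneg hξ.le δ 2 (x' - y)
    positivity
  -- inner sums: the sharp composition
  have hconv : ∀ z, Summable (fun x' => ξ ^ 3 * (prof ξ δ 2 (z - x') * prof ξ δ 2 (x' - y))) ∧
      ∑' x', ξ ^ 3 * (prof ξ δ 2 (z - x') * prof ξ δ 2 (x' - y)) ≤ 1400 * prof ξ (δ / 2) 1 (z - y) := by
    intro z
    obtain ⟨hs, hle⟩ := conv22_le₂ hξ hδ z y
    refine ⟨hs, hle.trans_eq ?_⟩
    rw [prof, pow_one]
  have hFz : ∀ z, Summable (F z) := fun z => ((hconv z).1.mul_left _).mul_left _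
  set H : ZSite 3 → ℝ := fun z => (C * C * b * 1400) * (ξ ^ 3 * (prof ξ (δ / 2) 1 (y - z) * prof ξ (δ / 2) 1 (z - y)))
    with hH
  have hFH : ∀ z, ∑' x', F z x' ≤ H z := by
    intro z
    simp only [hF, hH]
    rw [tsum_mul_left, tsum_mul_left]
    have h1 := (hconv z).2
    have h2 : prof ξ δ 1 (y - z) ≤ prof ξ (δ / 2) 1 (y - z) := prof_mono_rate hξ.le (by linarith) 1 (y - z)
    have hp0 := prof_nonneg hξ.le δ 1 (y - z)
    have hq0 := prof_nonneg hξ.le (δ / 2) 1 (z - y)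
    calc C * C * b * (ξ ^ 3 * prof ξ δ 1 (y - z) * ∑' x', ξ ^ 3 * (prof ξ δ 2 (z - x') * prof ξ δ 2 (x' - y)))
        ≤ C * C * b * (ξ ^ 3 * prof ξ (δ / 2) 1 (y - z) * (1400 * prof ξ (δ / 2) 1 (z - y))) := by
          refine mul_le_mul_of_nonneg_left ?_ (by positivity)
          exact mul_le_mul (mul_le_mul_of_nonneg_left h2 (by positivity)) h1
            (tsum_nonneg fun x' => by
              have := prof_nonneg hξ.le δ 2 (z - x'); have := prof_nonneg hξ.le δ 2 (x' - y); positivity)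
            (mul_nonneg (pow_nonneg hξ.le 3) (prof_nonneg hξ.le _ _ _))
      _ = _ := by ring
  have hδh : 0 < δ / 2 := by linarith
  have hδh1 : δ / 2 ≤ 1 := by linarith
  obtain ⟨hHs, hHle⟩ := tsum_profile_one_mul_le hξ hξ1 hδh hδh1 y y
  have hHsum : Summable H := hHs.mul_left _
  obtain ⟨hFx, hsx, hxle⟩ := tsum_tsum_le_of_nonneg hF0 hFz hFH hHsum
  -- the pointwise domination of the summand by the inner sum
  have hdom : ∀ x', |ξ ^ 3 * (dK2 ξ μ' (MxiL ℓ k a m2) y x' * κ x')| ≤ ∑' z, F z x' := by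
    intro x'
    rw [← (hasSum_dK2_MxiL hℓ hk ha hm μ' y x').tsum_eq, abs_mul, abs_mul,
      abs_of_pos (by positivity : (0 : ℝ) < ξ ^ 3)]
    have hint := summable_abs_dK2_integrand hℓ hk ha hm μ' y x'
    -- `|Σ' g| ≤ Σ' |g|`, then termwise
    have h1 : |∑' z, ξ ^ 3 * (smearG ℓ k a m2 y z * pdiffAdjZ ξ⁻¹ μ' (Cxi 3 ξ) (z - x'))| ≤
        ∑' z, |ξ ^ 3 * (smearG ℓ k a m2 y z * pdiffAdjZ ξ⁻¹ μ' (Cxi 3 ξ) (z - x'))| :=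
      abs_tsum_le_tsum_of_abs_le hint.of_abs hint (fun z => le_rfl)
    have hκ' := hκ x'
    have hk0 : 0 ≤ |κ x'| := abs_nonneg _
    calc ξ ^ 3 * (|∑' z, ξ ^ 3 * (smearG ℓ k a m2 y z * pdiffAdjZ ξ⁻¹ μ' (Cxi 3 ξ) (z - x'))| * |κ x'|)
        ≤ ξ ^ 3 * ((∑' z, |ξ ^ 3 * (smearG ℓ k a m2 y z * pdiffAdjZ ξ⁻¹ μ' (Cxi 3 ξ) (z - x'))|) *
            (b * prof ξ δ 2 (x' - y))) :=
          mul_le_mul_of_nonneg_left (mul_le_mul h1 hκ' hk0 (tsum_nonneg fun z => abs_nonneg _)) (by positivity)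
      _ = ∑' z, ξ ^ 3 * (b * prof ξ δ 2 (x' - y)) *
            |ξ ^ 3 * (smearG ℓ k a m2 y z * pdiffAdjZ ξ⁻¹ μ' (Cxi 3 ξ) (z - x'))| := by
          rw [mul_comm (∑' z, |ξ ^ 3 * (smearG ℓ k a m2 y z * pdiffAdjZ ξ⁻¹ μ' (Cxi 3 ξ) (z - x'))|) _, ← mul_assoc,
            ← tsum_mul_left]
      _ ≤ ∑' z, F z x' := by
          refine (hint.mul_left _).tsum_le_tsum (fun z => ?_) (hFx x')
          simp only [hF]
          rw [abs_mul, abs_mul, abs_of_pos (by positivity : (0 : ℝ) < ξ ^ 3)]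
          have hp2 := prof_nonneg hξ.le δ 2 (x' - y)
          have hs := hS1 y z
          have hc := hCa μ' (z - x')
          calc ξ ^ 3 * (b * prof ξ δ 2 (x' - y)) * (ξ ^ 3 * (|smearG ℓ k a m2 y z| *
                |pdiffAdjZ ξ⁻¹ μ' (Cxi 3 ξ) (z - x')|))
              ≤ ξ ^ 3 * (b * prof ξ δ 2 (x' - y)) * (ξ ^ 3 * ((C * prof ξ δ 1 (y - z)) * (C * prof ξ δ 2 (z - x')))) := by
                refine mul_le_mul_of_nonneg_left ?_ (by positivity)
                refine mul_le_mul_of_nonneg_left ?_ (by positivity)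
                exact mul_le_mul hs hc (abs_nonneg _) (by have := prof_nonneg hξ.le δ 1 (y - z); positivity)
            _ = _ := by ring
  have hsum : Summable (fun x' => ξ ^ 3 * (dK2 ξ μ' (MxiL ℓ k a m2) y x' * κ x')) :=
    (Summable.of_nonneg_of_le (fun x' => abs_nonneg _) hdom hsx).of_abs
  refine ⟨hsum, ?_⟩
  calc |∑' x', ξ ^ 3 * (dK2 ξ μ' (MxiL ℓ k a m2) y x' * κ x')| ≤ ∑' x', ∑' z, F z x' :=
        abs_tsum_le_tsum_of_abs_le hsum hsx hdom
    _ ≤ ∑' z, H z := hxle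
    _ = (C * C * b * 1400) * ∑' z, ξ ^ 3 * (prof ξ (δ / 2) 1 (y - z) * prof ξ (δ / 2) 1 (z - y)) := by
        simp only [hH]; rw [tsum_mul_left]
    _ ≤ (C * C * b * 1400) * (833 / (δ / 2) ^ 3) := mul_le_mul_of_nonneg_left hHle (by positivity)
    _ = C * C * b * (1400 * (833 / (δ / 2) ^ 3)) := by ring

/-- **THE TRANSPOSED FUBINI BOUND**: given the laws with rate `δ` and any `κ` with `|κ(y′)| ≤ b·P₁^δ(y′ − y)` (a weighted
once-differentiated leg, e.g. `(C^ξ∂^*_{μ′})(y−y′)·ξ(y′−y)_ν` of Π_{μμ′ν}), `y′ ↦ ξ³(∂^ξ_μM)(y,y′)κ(y′)` is summable and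
`|Σ'_{y′} ξ³(∂^ξ_μM)(y,y′)κ(y′)| ≤ C²·b·(833/δ³)²`: inside `∂_μM = Σ_z(∂_μ[G(1−m²−aP)])(y,z)C^ξ(z−y′)` the `y′`-sum is done first
(`Σ_{y′}ξ³P₁(z−y′)P₁(y′−y) ≤ 833/δ³`, AM–GM), then `Σ_zξ³P₂(y−z) ≤ 833/δ³`. [cite: Balaban1983Higgs3, (3.16) p.437] -/
theorem fubini_bound_transposed_of_laws (hℓ : 1 ≤ ℓ) (hk : 1 ≤ k) (ha : 0 < a) (hm : 0 ≤ m2) {δ C : ℝ} (hδ : 0 < δ)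
    (hδ1 : δ ≤ 1) (hC : 0 ≤ C)
    (hS2 : ∀ (μ : Fin 3) (y z : ZSite 3), |dK1 (xiOf ℓ k) μ (smearG ℓ k a m2) y z| ≤ C * prof (xiOf ℓ k) δ 2 (y - z))
    (hCx : ∀ u : ZSite 3, |Cxi 3 (xiOf ℓ k) u| ≤ C * prof (xiOf ℓ k) δ 1 u)
    (μ : Fin 3) (y : ZSite 3) {κ : ZSite 3 → ℝ} {b : ℝ} (hb : 0 ≤ b)
    (hκ : ∀ y', |κ y'| ≤ b * prof (xiOf ℓ k) δ 1 (y' - y)) :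
    Summable (fun y' => (xiOf ℓ k) ^ 3 * (dK1 (xiOf ℓ k) μ (MxiL ℓ k a m2) y y' * κ y')) ∧
      |∑' y', (xiOf ℓ k) ^ 3 * (dK1 (xiOf ℓ k) μ (MxiL ℓ k a m2) y y' * κ y')| ≤
        C * C * b * ((833 / δ ^ 3) * (833 / δ ^ 3)) := by
  have hξ := xiOf_pos ℓ k
  have hξ1 := xiOf_le_one ℓ k
  set ξ : ℝ := xiOf ℓ k with hξdef
  set F : ZSite 3 → ZSite 3 → ℝ := fun z y' =>
    (C * C * b) * ((ξ ^ 3 * prof ξ δ 2 (y - z)) * (ξ ^ 3 * (prof ξ δ 1 (z - y') * prof ξ δ 1 (y' - y)))) with hF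
  have hF0 : ∀ z y', 0 ≤ F z y' := fun z y' => by
    simp only [hF]
    have := prof_nonneg hξ.le δ 2 (y - z); have := prof_nonneg hξ.le δ 1 (z - y')
    have := prof_nonneg hξ.le δ 1 (y' - y)
    positivity
  have hconv : ∀ z, Summable (fun y' => ξ ^ 3 * (prof ξ δ 1 (z - y') * prof ξ δ 1 (y' - y))) ∧
      ∑' y', ξ ^ 3 * (prof ξ δ 1 (z - y') * prof ξ δ 1 (y' - y)) ≤ 833 / δ ^ 3 := fun z =>
    tsum_profile_one_mul_le hξ hξ1 hδ hδ1 z y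
  have hFz : ∀ z, Summable (F z) := fun z => ((hconv z).1.mul_left _).mul_left _
  set H : ZSite 3 → ℝ := fun z => (C * C * b * (833 / δ ^ 3)) * (ξ ^ 3 * prof ξ δ 2 (y - z)) with hH
  have hFH : ∀ z, ∑' y', F z y' ≤ H z := by
    intro z
    simp only [hF, hH]
    rw [tsum_mul_left, tsum_mul_left]
    have h1 := (hconv z).2
    have hp0 := prof_nonneg hξ.le δ 2 (y - z)
    calc C * C * b * (ξ ^ 3 * prof ξ δ 2 (y - z) * ∑' y', ξ ^ 3 * (prof ξ δ 1 (z - y') * prof ξ δ 1 (y' - y)))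
        ≤ C * C * b * (ξ ^ 3 * prof ξ δ 2 (y - z) * (833 / δ ^ 3)) :=
          mul_le_mul_of_nonneg_left (mul_le_mul_of_nonneg_left h1 (by positivity)) (by positivity)
      _ = _ := by ring
  obtain ⟨⟨hHs, hHle⟩, -⟩ := tsum_profile_shift_le hξ hξ1 hδ hδ1 (le_refl 2) y y
  have hHsum : Summable H := hHs.mul_left _
  obtain ⟨hFx, hsx, hxle⟩ := tsum_tsum_le_of_nonneg hF0 hFz hFH hHsum
  have hdom : ∀ y', |ξ ^ 3 * (dK1 ξ μ (MxiL ℓ k a m2) y y' * κ y')| ≤ ∑' z, F z y' := by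
    intro y'
    rw [← (hasSum_dK1_MxiL hℓ hk ha hm μ y y').tsum_eq, abs_mul, abs_mul,
      abs_of_pos (by positivity : (0 : ℝ) < ξ ^ 3)]
    have hint := summable_abs_dK1_integrand hℓ hk ha hm μ y y'
    have h1 : |∑' z, ξ ^ 3 * (dK1 ξ μ (smearG ℓ k a m2) y z * Cxi 3 ξ (z - y'))| ≤
        ∑' z, |ξ ^ 3 * (dK1 ξ μ (smearG ℓ k a m2) y z * Cxi 3 ξ (z - y'))| :=
      abs_tsum_le_tsum_of_abs_le hint.of_abs hint (fun z => le_rfl)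
    have hκ' := hκ y'
    have hk0 : 0 ≤ |κ y'| := abs_nonneg _
    calc ξ ^ 3 * (|∑' z, ξ ^ 3 * (dK1 ξ μ (smearG ℓ k a m2) y z * Cxi 3 ξ (z - y'))| * |κ y'|)
        ≤ ξ ^ 3 * ((∑' z, |ξ ^ 3 * (dK1 ξ μ (smearG ℓ k a m2) y z * Cxi 3 ξ (z - y'))|) * (b * prof ξ δ 1 (y' - y))) :=
          mul_le_mul_of_nonneg_left (mul_le_mul h1 hκ' hk0 (tsum_nonneg fun z => abs_nonneg _)) (by positivity)
      _ = ∑' z, ξ ^ 3 * (b * prof ξ δ 1 (y' - y)) * |ξ ^ 3 * (dK1 ξ μ (smearG ℓ k a m2) y z * Cxi 3 ξ (z - y'))| := by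
          rw [mul_comm (∑' z, |ξ ^ 3 * (dK1 ξ μ (smearG ℓ k a m2) y z * Cxi 3 ξ (z - y'))|) _, ← mul_assoc,
            ← tsum_mul_left]
      _ ≤ ∑' z, F z y' := by
          refine (hint.mul_left _).tsum_le_tsum (fun z => ?_) (hFx y')
          simp only [hF]
          rw [abs_mul, abs_mul, abs_of_pos (by positivity : (0 : ℝ) < ξ ^ 3)]
          have hp1 := prof_nonneg hξ.le δ 1 (y' - y)
          have hs := hS2 μ y z
          have hc := hCx (z - y')
          calc ξ ^ 3 * (b * prof ξ δ 1 (y' - y)) * (ξ ^ 3 * (|dK1 ξ μ (smearG ℓ k a m2) y z| * |Cxi 3 ξ (z - y')|))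
              ≤ ξ ^ 3 * (b * prof ξ δ 1 (y' - y)) * (ξ ^ 3 * ((C * prof ξ δ 2 (y - z)) * (C * prof ξ δ 1 (z - y')))) := by
                refine mul_le_mul_of_nonneg_left ?_ (by positivity)
                refine mul_le_mul_of_nonneg_left ?_ (by positivity)
                exact mul_le_mul hs hc (abs_nonneg _) (by have := prof_nonneg hξ.le δ 2 (y - z); positivity)
            _ = _ := by ring
  have hsum : Summable (fun y' => ξ ^ 3 * (dK1 ξ μ (MxiL ℓ k a m2) y y' * κ y')) :=
    (Summable.of_nonneg_of_le (fun y' => abs_nonneg _) hdom hsx).of_abs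
  refine ⟨hsum, ?_⟩
  calc |∑' y', ξ ^ 3 * (dK1 ξ μ (MxiL ℓ k a m2) y y' * κ y')| ≤ ∑' y', ∑' z, F z y' :=
        abs_tsum_le_tsum_of_abs_le hsum hsx hdom
    _ ≤ ∑' z, H z := hxle
    _ = (C * C * b * (833 / δ ^ 3)) * ∑' z, ξ ^ 3 * prof ξ δ 2 (y - z) := by
        simp only [hH]; rw [tsum_mul_left]
    _ ≤ (C * C * b * (833 / δ ^ 3)) * (833 / δ ^ 3) := mul_le_mul_of_nonneg_left hHle (by positivity)
    _ = C * C * b * ((833 / δ ^ 3) * (833 / δ ^ 3)) := by ring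

end MBounds

/-! ## §7 Everything at once: one rate, one set of constants -/

section Bundle

variable {ℓ : ℕ}

/-- **THE ESTIMATES OF (3.16) ON THE PRINTED INFINITE LATTICE, bundled** (one rate `0 < δ ≤ ½`, constants functions of `L` and
the window, UNIFORM IN `k ≥ 1`): the nine kernel laws of `exists_laws`; `|M(y,y′)| ≤ C₀`; `|(∂_{μ′}M∂^*_μ)(x,y)| ≤ C₂P₁^{δ/2}(x−y)`;
the crude `|(M∂^*_{μ′})(y,x′)| ≤ C₁ξ^{−1}`; the Fubini bound `|Σ'_{x′}ξ³(M∂^*_{μ′})(y,x′)κ(x′)| ≤ K·b` for every `κ` with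
`|κ(x′)| ≤ bP₂^δ(x′−y)`, its version at any weaker rate `0 < δ′ ≤ δ`, and the transposed Fubini bound for `(∂_μM)(y,·)` against
`|κ| ≤ bP₁^δ`. [cite: Balaban1983Higgs3, (3.16) p.437] -/
theorem exists_bounds (hℓ : 1 ≤ ℓ) (amin aplus m2plus : ℝ) (ha : 0 < amin) :
    ∃ δ C K : ℝ, 0 < δ ∧ δ ≤ 1 / 2 ∧ 1 ≤ C ∧ 0 < K ∧ ∀ (k : ℕ), 1 ≤ k → ∀ (a m2 : ℝ), amin ≤ a → a ≤ aplus → 0 ≤ m2 →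
      m2 ≤ m2plus →
      ((∀ y z : ZSite 3, |GxiL ℓ k a m2 y z| ≤ C * prof (xiOf ℓ k) δ 1 (y - z)) ∧
        (∀ (μ : Fin 3) (y z : ZSite 3), |dK1 (xiOf ℓ k) μ (GxiL ℓ k a m2) y z| ≤ C * prof (xiOf ℓ k) δ 2 (y - z)) ∧
        (∀ (μ : Fin 3) (y z : ZSite 3), |dK2 (xiOf ℓ k) μ (GxiL ℓ k a m2) y z| ≤ C * prof (xiOf ℓ k) δ 2 (y - z)) ∧
        (∀ (μ' μ : Fin 3) (x y : ZSite 3), |d2K (xiOf ℓ k) μ' μ (GxiL ℓ k a m2) x y| ≤ C * prof (xiOf ℓ k) δ 3 (x - y)) ∧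
        (∀ y z : ZSite 3, |smearG ℓ k a m2 y z| ≤ C * prof (xiOf ℓ k) δ 1 (y - z)) ∧
        (∀ (μ : Fin 3) (y z : ZSite 3), |dK1 (xiOf ℓ k) μ (smearG ℓ k a m2) y z| ≤ C * prof (xiOf ℓ k) δ 2 (y - z)) ∧
        (∀ u : ZSite 3, |Cxi 3 (xiOf ℓ k) u| ≤ C * prof (xiOf ℓ k) δ 1 u) ∧
        (∀ (μ : Fin 3) (u : ZSite 3), |pdiffAdjZ (xiOf ℓ k)⁻¹ μ (Cxi 3 (xiOf ℓ k)) u| ≤ C * prof (xiOf ℓ k) δ 2 u) ∧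
        (∀ (μ : Fin 3) (u : ZSite 3), |pdiffZ (xiOf ℓ k)⁻¹ μ (Cxi 3 (xiOf ℓ k)) u| ≤ C * prof (xiOf ℓ k) δ 2 u)) ∧
      (∀ y y' : ZSite 3, |MxiL ℓ k a m2 y y'| ≤ K) ∧
      (∀ (μ' μ : Fin 3) (x y : ZSite 3), |d2K (xiOf ℓ k) μ' μ (MxiL ℓ k a m2) x y| ≤ K * prof (xiOf ℓ k) (δ / 2) 1 (x - y)) ∧
      (∀ (μ' : Fin 3) (y x' : ZSite 3), |dK2 (xiOf ℓ k) μ' (MxiL ℓ k a m2) y x'| ≤ (xiOf ℓ k)⁻¹ * K) ∧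
      (∀ (μ' : Fin 3) (y : ZSite 3) (κ : ZSite 3 → ℝ) (b : ℝ), 0 ≤ b →
        (∀ x', |κ x'| ≤ b * prof (xiOf ℓ k) δ 2 (x' - y)) →
        Summable (fun x' => (xiOf ℓ k) ^ 3 * (dK2 (xiOf ℓ k) μ' (MxiL ℓ k a m2) y x' * κ x')) ∧
          |∑' x', (xiOf ℓ k) ^ 3 * (dK2 (xiOf ℓ k) μ' (MxiL ℓ k a m2) y x' * κ x')| ≤ K * b) ∧
      (∀ (δ' : ℝ), 0 < δ' → δ' ≤ δ → ∀ (μ' : Fin 3) (y : ZSite 3) (κ : ZSite 3 → ℝ) (b : ℝ), 0 ≤ b →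
        (∀ x', |κ x'| ≤ b * prof (xiOf ℓ k) δ' 2 (x' - y)) →
        Summable (fun x' => (xiOf ℓ k) ^ 3 * (dK2 (xiOf ℓ k) μ' (MxiL ℓ k a m2) y x' * κ x')) ∧
          |∑' x', (xiOf ℓ k) ^ 3 * (dK2 (xiOf ℓ k) μ' (MxiL ℓ k a m2) y x' * κ x')| ≤
            C * C * b * (1400 * (833 / (δ' / 2) ^ 3))) ∧
      (∀ (μ : Fin 3) (y : ZSite 3) (κ : ZSite 3 → ℝ) (b : ℝ), 0 ≤ b →
        (∀ y', |κ y'| ≤ b * prof (xiOf ℓ k) δ 1 (y' - y)) →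
        Summable (fun y' => (xiOf ℓ k) ^ 3 * (dK1 (xiOf ℓ k) μ (MxiL ℓ k a m2) y y' * κ y')) ∧
          |∑' y', (xiOf ℓ k) ^ 3 * (dK1 (xiOf ℓ k) μ (MxiL ℓ k a m2) y y' * κ y')| ≤
            C * C * b * ((833 / δ ^ 3) * (833 / δ ^ 3))) := by
  obtain ⟨δ, C, hδ, hδh, hC1, hL⟩ := exists_laws hℓ amin aplus m2plus ha
  have hδ1 : δ ≤ 1 := hδh.trans (by norm_num)
  have hC0 : 0 ≤ C := le_trans (by norm_num) hC1
  set K : ℝ := C * C * (1400 * (833 / (δ / 2) ^ 3)) with hKdef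
  have hδh0 : 0 < δ / 2 := by linarith
  have hK0 : 0 < K := by positivity
  -- `K` dominates the three other constants
  have h833 : 833 / δ ^ 3 ≤ 1400 * (833 / (δ / 2) ^ 3) := by
    have hd3 : (δ / 2) ^ 3 ≤ δ ^ 3 := pow_le_pow_left₀ hδh0.le (by linarith) 3
    have h1 : 833 / δ ^ 3 ≤ 833 / (δ / 2) ^ 3 := div_le_div_of_nonneg_left (by norm_num) (by positivity) hd3
    have h2 : 833 / (δ / 2) ^ 3 ≤ 1400 * (833 / (δ / 2) ^ 3) := le_mul_of_one_le_left (by positivity) (by norm_num)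
    exact h1.trans h2
  have hK1 : C * C * (833 / δ ^ 3) ≤ K := mul_le_mul_of_nonneg_left h833 (by positivity)
  have hK2 : C * C * 1400 ≤ K := by
    rw [hKdef]
    refine mul_le_mul_of_nonneg_left ?_ (by positivity)
    have : (1 : ℝ) ≤ 833 / (δ / 2) ^ 3 := by
      rw [le_div_iff₀ (by positivity)]
      have : (δ / 2) ^ 3 ≤ 1 := pow_le_one₀ hδh0.le (by linarith)
      linarith
    nlinarith
  refine ⟨δ, C, K, hδ, hδh, hC1, hK0, ?_⟩
  intro k hk a m2 ha1 ha2 hm1 hm2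
  have ha0 : 0 < a := ha.trans_le ha1
  obtain ⟨l1, l2, l3, l4, l5, l6, l7, l8, l9⟩ := hL k hk a m2 ha1 ha2 hm1 hm2
  have hξ := xiOf_pos ℓ k
  refine ⟨⟨l1, l2, l3, l4, l5, l6, l7, l8, l9⟩, fun y y' => ?_, fun μ' μ x y => ?_, fun μ' y x' => ?_,
    fun μ' y κ b hb hκ => ?_, fun δ' hδ' hδ'δ μ' y κ b hb hκ => ?_, fun μ y κ b hb hκ => ?_⟩
  · exact (abs_MxiL_le_of_laws hℓ hk ha0 hm1 hδ hδ1 hC0 l5 l7 y y').trans hK1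
  · exact (abs_d2K_MxiL_le_of_laws hℓ hk ha0 hm1 hδ hC0 l6 l8 μ' μ x y).trans
      (mul_le_mul_of_nonneg_right hK2 (prof_nonneg hξ.le _ _ _))
  · exact (abs_dK2_MxiL_le_unif hℓ hk ha0 hm1 hδ hδ1 hC0 l5 l8 μ' y x').trans
      (mul_le_mul_of_nonneg_left hK1 (by positivity))
  · obtain ⟨hs, hle⟩ := fubini_bound_of_laws hℓ hk ha0 hm1 hδ hδ1 hC0 l5 l8 μ' y hb hκ
    exact ⟨hs, hle.trans_eq (by rw [hKdef]; ring)⟩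
  · -- the laws at the weaker rate `δ'`
    have l5' : ∀ y z : ZSite 3, |smearG ℓ k a m2 y z| ≤ C * prof (xiOf ℓ k) δ' 1 (y - z) := fun y z =>
      (l5 y z).trans (mul_le_mul_of_nonneg_left (prof_mono_rate hξ.le hδ'δ 1 _) hC0)
    have l8' : ∀ (μ : Fin 3) (u : ZSite 3), |pdiffAdjZ (xiOf ℓ k)⁻¹ μ (Cxi 3 (xiOf ℓ k)) u| ≤
        C * prof (xiOf ℓ k) δ' 2 u := fun μ u =>
      (l8 μ u).trans (mul_le_mul_of_nonneg_left (prof_mono_rate hξ.le hδ'δ 2 _) hC0)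
    exact fubini_bound_of_laws hℓ hk ha0 hm1 hδ' (hδ'δ.trans hδ1) hC0 l5' l8' μ' y hb hκ
  · exact fubini_bound_transposed_of_laws hℓ hk ha0 hm1 hδ hδ1 hC0 l6 l7 μ y hb hκ

end Bundle

end

end Literature.MathematicalPhysics.QuantumFieldTheory.Balaban1983to89.B3Eq316DifferenceKernelBounds
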